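import Summits.ValiantsHypothesis.ValiantsHypothesis.Theorems.MonotoneRestorationOrbitRestorationQPSignFree
import HarnessLib

/-!
# The sign of an involution on a product of lines (ORBIT currency, ΠΣ sub-rung)

Route MonotoneRestoration, crux `OrbitRestorationQP` (stmt-ValiantsHypothesis-18293), line `depth-three-rung`,
stub A₁ `stub_piSigmaValue`, namespace `Summit.ValiantsHypothesis.ValiantsHypothesis.Theorems.SignCount`.

The parity conditions (MID) and (TOP) of the keyed-block theorem
(`KeyedBlocks.qpOrbitRestorable_of_keyedBlocks`) ask that a transposition FIXES a block product `Π A` whose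
factor multiset `A` it permutes up to units.  This file turns that into a COUNT, generalising the sign-free
lemma `SignFree.prod_map_ren_eq_of_signFree`:

* `prod_map_ren_eq_neg_one_pow_mul` — for an involution `τ` and a multiset `A` of nonzero polynomials with
  `τ · A` and `A` having the same associates, `Π (τ · A) = (-1)^N · Π A`, where `N` is the number of members
  `ℓ ∈ A` (with multiplicity) that `τ` NEGATES (`τ · ℓ = -ℓ`): a member on a `τ`-fixed line is rescaled by
  `±1`, and two members exchanged by `τ` carry inverse units and are negated together or not at all;
* `ren_prod_eq_self_iff_even` — hence `τ` fixes `Π A` iff `N` is even (`Π A ≠ 0`, characteristic `0`).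

So (TOP) at a key `K` reads: for all `x, y ∈ K`, the number of factors keyed `K` negated by `(x y)` is even —
the form in which the crux workfile `Cruxes/OrbitRestorationQP/PISIGMA-SUBRUNG.md` (rule M2′, parity lemma)
verifies it.  Everything is proved. [folklore]

## References
* A. Dawar, G. Wilsenach, *Symmetric arithmetic circuits*, ToC 21 (2025), §3.3, Def. 6.1. [DawarWilsenach2025]
-/

noncomputable section

open scoped Classical

-- `Summit.ValiantsHypothesis.ValiantsHypothesis.…` is the tree's single-conjunct layout (Sub = Summit).
set_option linter.dupNamespace false

namespace Summit.ValiantsHypothesis.ValiantsHypothesis.Theorems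

namespace SignCount

open Equiv

variable {n : ℕ}

/-- A nonzero polynomial over `ℂ` is not its own negative. [folklore] -/
theorem ne_neg_self {ℓ : MvPolynomial (Fin n × Fin n) ℂ} (hℓ : ℓ ≠ 0) : ℓ ≠ -ℓ := by
  intro h
  have h2 : (MvPolynomial.C (2 : ℂ)) * ℓ = 0 := by
    rw [show (MvPolynomial.C (2 : ℂ) : MvPolynomial (Fin n × Fin n) ℂ) = 2 from map_ofNat _ 2, two_mul]
    nth_rewrite 1 [h]
    rw [neg_add_cancel]
  rcases mul_eq_zero.1 h2 with h3 | h3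
  · exact two_ne_zero (MvPolynomial.C_eq_zero.1 h3)
  · exact hℓ h3

/-- Transport of negation along an exchanged pair: if `τ ℓ = u ℓ'`, `τ ℓ' = u⁻¹ ℓ` and `τ ℓ = -ℓ`, then
`τ ℓ' = -ℓ'`. [folklore] -/
theorem ren_eq_neg_of_partner (τ : Perm (Fin n)) {ℓ ℓ' : MvPolynomial (Fin n × Fin n) ℂ} {u : ℂ} (hu0 : u ≠ 0)
    (hu : ren τ ℓ = MvPolynomial.C u * ℓ') (hu' : ren τ ℓ' = MvPolynomial.C u⁻¹ * ℓ) (hneg : ren τ ℓ = -ℓ) :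
    ren τ ℓ' = -ℓ' := by
  have h1 : ℓ' = MvPolynomial.C u⁻¹ * (-ℓ) := by
    calc ℓ' = MvPolynomial.C (u⁻¹ * u) * ℓ' := by rw [inv_mul_cancel₀ hu0, map_one, one_mul]
      _ = MvPolynomial.C u⁻¹ * (MvPolynomial.C u * ℓ') := by rw [map_mul, mul_assoc]
      _ = MvPolynomial.C u⁻¹ * (-ℓ) := by rw [← hu, hneg]
  rw [hu', h1]
  ring

/-- **THE SIGN OF AN INVOLUTION ON A PRODUCT OF LINES.**  Let `τ` be an involution and `A` a multiset of nonzero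
polynomials such that `τ · A` and `A` have the same associates.  Then `Π (τ · A) = (-1)^N · Π A` where `N` is
the number of members of `A` negated by `τ`. [folklore] -/
theorem prod_map_ren_eq_neg_one_pow_mul (τ : Perm (Fin n)) (hτ : τ * τ = 1) :
    ∀ (A : Multiset (MvPolynomial (Fin n × Fin n) ℂ)), (∀ ℓ ∈ A, ℓ ≠ 0) →
      (A.map (ren τ)).map Associates.mk = A.map Associates.mk →
      (A.map (ren τ)).prod =
        (-1) ^ Multiset.card (A.filter fun ℓ => ren τ ℓ = -ℓ) * A.prod := by
  have hττ : ∀ p : MvPolynomial (Fin n × Fin n) ℂ, ren τ (ren τ p) = p := fun p => by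
    rw [← ren_mul, hτ, ren_one]
  intro A
  induction h : Multiset.card A using Nat.strong_induction_on generalizing A with
  | _ N ih =>
    intro hA0 hmk
    rcases Multiset.empty_or_exists_mem A with rfl | ⟨ℓ, hℓ⟩
    · simp
    · -- `τ ℓ` is associated to some member `ℓ'`
      have hmem : Associates.mk (ren τ ℓ) ∈ A.map Associates.mk := by
        rw [← hmk]; exact Multiset.mem_map.2 ⟨ren τ ℓ, Multiset.mem_map.2 ⟨ℓ, hℓ, rfl⟩, rfl⟩
      obtain ⟨ℓ', hℓ', hℓ'eq⟩ := Multiset.mem_map.1 hmem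
      obtain ⟨u, hu0, hu⟩ := SupportBlocks.exists_C_of_associated (Associates.mk_eq_mk_iff_associated.1 hℓ'eq)
      -- `hu : ren τ ℓ = C u * ℓ'`
      have hℓ0 : ℓ ≠ 0 := hA0 ℓ hℓ
      obtain ⟨A', rfl⟩ := Multiset.exists_cons_of_mem hℓ
      by_cases hfix : ℓ' = ℓ
      · -- fixed line: `u = ±1`
        rw [hfix] at hu
        have huu : u * u = 1 := by
          have h1 := congrArg (ren τ) hu
          rw [hττ, map_mul, ren_C, hu, ← mul_assoc, ← map_mul] at h1
          have h2 : MvPolynomial.C (u * u) * ℓ = MvPolynomial.C 1 * ℓ := by rw [map_one, one_mul]; exact h1.symm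
          exact MvPolynomial.C_injective _ _ (mul_right_cancel₀ hℓ0 h2)
        have e0 : Associates.mk (MvPolynomial.C u * ℓ) = Associates.mk ℓ :=
          Associates.mk_eq_mk_iff_associated.2
            (associated_unit_mul_left _ _ ((isUnit_iff_ne_zero.2 hu0).map MvPolynomial.C))
        have hmk' : (A'.map (ren τ)).map Associates.mk = A'.map Associates.mk := by
          rw [Multiset.map_cons, Multiset.map_cons, Multiset.map_cons, hu, e0] at hmk
          exact (Multiset.cons_inj_right _).1 hmk
        have hIH := ih (Multiset.card A') (by rw [← h, Multiset.card_cons]; exact Nat.lt_succ_self _) A' rfl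
          (fun x hx => hA0 x (Multiset.mem_cons_of_mem hx)) hmk'
        rcases mul_self_eq_one_iff.1 huu with rfl | rfl
        · -- `u = 1`: `ℓ` is fixed, not negated
          rw [map_one, one_mul] at hu
          have hnot : ¬ren τ ℓ = -ℓ := by rw [hu]; exact ne_neg_self hℓ0
          rw [Multiset.filter_cons_of_neg (p := fun q => ren τ q = -q) _ hnot, Multiset.map_cons, Multiset.prod_cons,
            Multiset.prod_cons, hu, hIH]
          ring
        · -- `u = -1`: `ℓ` is negated
          have hyes : ren τ ℓ = -ℓ := by rw [hu, map_neg, map_one]; ring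
          rw [Multiset.filter_cons_of_pos (p := fun q => ren τ q = -q) _ hyes, Multiset.card_cons, Multiset.map_cons,
            Multiset.prod_cons, Multiset.prod_cons, hyes, hIH, pow_succ]
          ring
      · -- exchanged pair: `τ ℓ = u ℓ'`, `τ ℓ' = u⁻¹ ℓ`, negated together or not at all
        have hℓ'A' : ℓ' ∈ A' := (Multiset.mem_cons.1 hℓ').resolve_left hfix
        obtain ⟨A'', rfl⟩ := Multiset.exists_cons_of_mem hℓ'A'
        have hu' : ren τ ℓ' = MvPolynomial.C u⁻¹ * ℓ := by
          have h1 := congrArg (ren τ) hu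
          rw [hττ, map_mul, ren_C] at h1
          rw [h1, ← mul_assoc, ← map_mul, inv_mul_cancel₀ hu0, map_one, one_mul]
        have e1 : Associates.mk (MvPolynomial.C u * ℓ') = Associates.mk ℓ' :=
          Associates.mk_eq_mk_iff_associated.2
            (associated_unit_mul_left _ _ ((isUnit_iff_ne_zero.2 hu0).map MvPolynomial.C))
        have e2 : Associates.mk (MvPolynomial.C u⁻¹ * ℓ) = Associates.mk ℓ :=
          Associates.mk_eq_mk_iff_associated.2
            (associated_unit_mul_left _ _ ((isUnit_iff_ne_zero.2 (inv_ne_zero hu0)).map MvPolynomial.C))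
        have hmk'' : (A''.map (ren τ)).map Associates.mk = A''.map Associates.mk := by
          have h3 : Associates.mk ℓ' ::ₘ Associates.mk ℓ ::ₘ (A''.map (ren τ)).map Associates.mk =
              Associates.mk ℓ ::ₘ Associates.mk ℓ' ::ₘ A''.map Associates.mk := by
            have h4 := hmk
            rw [Multiset.map_cons, Multiset.map_cons, Multiset.map_cons, Multiset.map_cons, Multiset.map_cons,
              Multiset.map_cons, hu, hu', e1, e2] at h4
            exact h4
          rw [Multiset.cons_swap] at h3
          exact (Multiset.cons_inj_right _).1 ((Multiset.cons_inj_right _).1 h3)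
        have hcard : Multiset.card A'' < N := by
          rw [← h, Multiset.card_cons, Multiset.card_cons]; omega
        have hIH := ih _ hcard A'' rfl (fun x hx => hA0 x (Multiset.mem_cons_of_mem (Multiset.mem_cons_of_mem hx)))
          hmk''
        have hscal : MvPolynomial.C u * ℓ' * (MvPolynomial.C u⁻¹ * ℓ) = ℓ * ℓ' := by
          calc MvPolynomial.C u * ℓ' * (MvPolynomial.C u⁻¹ * ℓ)
              = MvPolynomial.C (u * u⁻¹) * (ℓ * ℓ') := by rw [map_mul]; ring
            _ = ℓ * ℓ' := by rw [mul_inv_cancel₀ hu0, map_one, one_mul]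
        have hiff : ren τ ℓ = -ℓ ↔ ren τ ℓ' = -ℓ' := by
          constructor
          · exact ren_eq_neg_of_partner τ hu0 hu hu'
          · intro hneg'
            have hu'' : ren τ ℓ = MvPolynomial.C u⁻¹⁻¹ * ℓ' := by rw [inv_inv]; exact hu
            exact ren_eq_neg_of_partner τ (inv_ne_zero hu0) hu' hu'' hneg'
        by_cases hneg : ren τ ℓ = -ℓ
        · rw [Multiset.filter_cons_of_pos (p := fun q => ren τ q = -q) _ hneg,
            Multiset.filter_cons_of_pos (p := fun q => ren τ q = -q) _ (hiff.1 hneg), Multiset.card_cons,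
            Multiset.card_cons, Multiset.map_cons, Multiset.map_cons, Multiset.prod_cons, Multiset.prod_cons,
            Multiset.prod_cons, Multiset.prod_cons, hu, hu', hIH, ← mul_assoc, hscal, pow_succ, pow_succ]
          ring
        · rw [Multiset.filter_cons_of_neg (p := fun q => ren τ q = -q) _ hneg,
            Multiset.filter_cons_of_neg (p := fun q => ren τ q = -q) _ (fun h' => hneg (hiff.2 h')),
            Multiset.map_cons, Multiset.map_cons, Multiset.prod_cons, Multiset.prod_cons, Multiset.prod_cons,
            Multiset.prod_cons, hu, hu', hIH, ← mul_assoc, hscal]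
          ring

/-- **PARITY FORM of "a transposition fixes a block".**  Under the hypotheses of
`prod_map_ren_eq_neg_one_pow_mul` and `Π A ≠ 0`, the involution `τ` fixes `Π A` iff the number of members of `A`
it negates is even. [folklore] -/
theorem ren_prod_eq_self_iff_even (τ : Perm (Fin n)) (hτ : τ * τ = 1)
    (A : Multiset (MvPolynomial (Fin n × Fin n) ℂ)) (hA0 : ∀ ℓ ∈ A, ℓ ≠ 0)
    (hmk : (A.map (ren τ)).map Associates.mk = A.map Associates.mk) :
    ren τ A.prod = A.prod ↔ Even (Multiset.card (A.filter fun ℓ => ren τ ℓ = -ℓ)) := by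
  have hprod : A.prod ≠ 0 := Multiset.prod_ne_zero fun h0 => hA0 0 h0 rfl
  rw [map_multiset_prod, prod_map_ren_eq_neg_one_pow_mul τ hτ A hA0 hmk]
  constructor
  · intro h
    have h1 : ((-1 : MvPolynomial (Fin n × Fin n) ℂ) ^ Multiset.card (A.filter fun ℓ => ren τ ℓ = -ℓ) - 1) *
        A.prod = 0 := by rw [sub_mul, one_mul, h, sub_self]
    have h2 := (mul_eq_zero.1 h1).resolve_right hprod
    rw [sub_eq_zero] at h2
    by_contra hodd
    rw [Nat.not_even_iff_odd] at hodd
    rw [hodd.neg_one_pow] at h2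
    exact ne_neg_self (n := n) one_ne_zero h2.symm
  · intro heven
    rw [heven.neg_one_pow, one_mul]

end SignCount

end Summit.ValiantsHypothesis.ValiantsHypothesis.Theorems

end
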